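import Summits.RiemannHypothesis.RiemannHypothesis.Theorems.JensenPolynomialsCapTailCompute

/-!
# Route `JensenPolynomials` — uniform tail of `XiCumulantMajorantCap` / `XiCumulantMajorantCapFar`, part T5:
the certificate RUN (cell rh-jensen, engine seat g4; RH-FREE, γ-FREE)

The one `ℕ` fixed-point certificate `tailCheck` of part T1 (`JensenPolynomialsCapTailCompute`: threshold `D⋆ = 100`,
`j`-cut `Jt = 60`, uniform caps, row weights, `etTab` table, geometric-envelope constant and `4^k`-weighted sum) evaluates
to `true` — by the KERNEL (`decide +kernel`, standard axioms; no `native_decide`).  The soundness parts T2–T4 turn this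
Boolean into «both majorant sums `< 1` for EVERY `d ≥ 100`» (items stmt-RiemannHypothesis-19217 / -19472).  Exact-integer
mirror of the same computation: `S₁⁺ = 0.9216`, `S₂⁺ = 0.3126`, `G⁺ = 58.9 ≤ 61`, `B⁺ + T⁺ = 0.823 ≤ 3`.
Nothing here bears on the truth of RH.
-/

-- D-0017: `Summit.RiemannHypothesis.RiemannHypothesis.…` duplicates the namespace BY DESIGN (single-problem summit).
set_option linter.dupNamespace false

namespace Summit.RiemannHypothesis.RiemannHypothesis.Theorems.JensenPolynomials.CapCert

/-- **The uniform tail certificate evaluates to `true`** (kernel evaluation, standard axioms). -/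
theorem tailCheck_true : tailCheck = true := by
  set_option maxRecDepth 100000 in decide +kernel

end Summit.RiemannHypothesis.RiemannHypothesis.Theorems.JensenPolynomials.CapCert
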